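import Summits.QuantumFields.YangMills.Theorems.BalabanUVNodesN12DirectChartPackageRepaired

/-!
# DAG node N12 [B15] — THE DIRECT ROAD's CHART HALF WITH ITS FOUR CONSTANTS QUANTIFIED PER HEIGHT, BEFORE THE INSTANCE
# (`exists_hWD_chartHalf_of_letters_uniform`; lane finding LOCATED-FLOOR, 2026-08-28T22:10Z)

[Balaban1989LargeFieldII] = «[LF-II]», p. 357, (1.7) p. 358, (1.12)–(1.13) p. 359; [Balaban1985Variational] = «[15]», Sect. C (44)–(48) p. 285, (81)–(83) p. 290;
[Balaban1988Convergent] = «[III]», (2.2) p. 255, (2.10)–(2.13) pp. 256–257; [Balaban1989LargeFieldI] = «[IV]», Prop. 1 p. 194 («for ε > 0 sufficiently small»).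

Cell `pub-ymgap`, HUMAN RULINGS D-0062 ∕ D-0149, lane owner `pub-ymgap-dag-n12-c` (g21) on node N12 (plan g87's ruling «(b-direct) GO»; repair pen (ρ1) of the lane finding
LOCATED-FLOOR).  Key K1⁹ `stmt-QuantumFields-27364`, `--kind proof --supports … --as helper`; count-neutral.  NEW leaf; CONSUMED BY NAME, nothing modified: this lane's
`N12DirectChartPackageRepaired` (p660018: `chartRows_direct_of_letters'`), dag-n12-w4's `N12NearFlatFederbushVelocityWindow.hmX_federbush_window_of_delta2Component` and
`N12NearFlatDelta2LetterComponent.exists_delta2_letter_component` (the (δ₂)-component constants `C ρ`: one pair per height), `N12DirectChartLetterCore.exists_twistSize_of_nearFlat_feeds`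
(the twist size `K_τ ρ_τ`: one pair per height).

WHY.  The direct road's endpoints ((P2c) p662019 and its successors) build their tolerance threshold `δ₀ i := min (min ρ ρ_τ ∕ 2) δ₁` from the chart half's constants, which
p660018's `exists_hWD_chartHalf_of_letters'` quantifies AFTER `ν` (hence after the class threshold `ν.εreg`) and after the instance's region; the endpoint then reads
`∃ δ₀ > 0, ∀ δ ≤ δ₀, …`.  As soon as a displayed row is a numeric FLOOR `tol(ν.εreg, ρn i) ≤ δ i` fixed by outer data, that frame is vacuous by shape (`δ₀ := tol ∕ 2`; kernel
certificate `B15Prop1NumericsThresholds.exists_threshold_frame_of_pos_floor`).  The cure is a quantifier order: the four constants exist PER HEIGHT `(F, Kt, k)` — they come from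
height-only producers — so they can be displayed as BINDERS `(C ρ K_τ ρ_τ : ι → ℝ)` with one chart-half LETTER (this file's ∀-body at `k i`), discharged by name BEFORE `ν` is
fixed, and the threshold becomes an explicit expression in them (`B15Prop1NumericsThresholds` §7).

CONTENTS (namespace `Summit.QuantumFields.YangMills.BalabanUVNodes.N12DirectChartPackageUniform`; theorems only — no `def`, no `instance`, no `sorry`).
* ★★★ `exists_hWD_chartHalf_of_letters_uniform` — `∃ C ρ K_τ ρ_τ` (signs) `∀ ν Z Λ T lo hi` (box-fits row, window-in-`Ω_k(Z)` row) + p660018 §2's ∀-body VERBATIM.  Proof: p660018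
  §2's with the two height-only producers obtained first.
* ★★ `exists_hWD_chartHalf_of_letters_uniform_family` — the family form over an instance family `k : ι → ℕ` (`choose`): constant families `C ρ K_τ ρ_τ : ι → ℝ` with, for
  every `i`, the ∀-body at height `k i` = the displayed letter `hhalf i` of (P2c)′ term-for-term (the consumer's one-line discharge, before `ν` is fixed).

HONEST FRAMING ∕ LOCATED.  A quantifier re-ordering over landed kernel theorems; the constants are EXISTENTIAL per height (compactness-type producers), NOT print's explicit
volume-uniform ones, and the (K)-row constant keeps its `√#bonds(Ω₁(Z))`; nothing of Bałaban's (1.7) ∕ (1.12) ∕ Prop. 1 is asserted; count-neutral helper; N12 NOT discharged;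
K1⁹ NOT closed; counts unmoved; one finite 𝕋⁴ programme at fixed ε — R4 closes the conditional finite-𝕋⁴ rung `BalabanLadder.UV` only; NOT continuum ∕ OS ∕ mass gap ∕ Clay.
-/

noncomputable section
open scoped BigOperators Matrix.Norms.L2Operator Topology
open Filter Finset

namespace Summit.QuantumFields.YangMills.BalabanUVNodes.N12DirectChartPackageUniform


open Literature.MathematicalPhysics.QuantumFieldTheory.Balaban1983to89
open Literature.MathematicalPhysics.QuantumLattice (quatMatrix)
open T4Continuum (T4Family)
open T4HaarSU2ExpChart (imQuat)
open T4AdjointCovarianceUnitary (lieSU)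
open T4CubeChartGnomonic (SU2)
open B15DeterminingSets GaugeField
open B14.Eq213DetSet (Bj Bj_of_gt maxDomT)
open B14.Eq216Concrete (feeds)
open B15Prop1SliceCoordinates (GaugeSlice ιA)
open B15Prop1ChartCalculusSU2 (E3)
open B15Prop1ChartSU2 (su2Chart)
open B16Sect1Backgrounds (expMul)
open T4AxialGaugeSmallField (castSite)
open B6TreeGaugePoincare (curl)
open B16Eq18Proof (box)
open LatticeFieldCalculus (runSite)
open BlockAveragingEMLLinearised (linAvg)
open Literature.MathematicalPhysics.QuantumFieldTheory.BalabanImbrieJaffe1984to88.BIJ85Eq453GaugeField (qsstarGIter0)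
open Node00
open B16Ineq19FlatSliceChart (exists_lieSU2Coord)
open Summit.QuantumFields.YangMills.BalabanUVNodes.N12NearFlatChartLetter (sum_opNorm_sq_le_l2Seminorm_sq l2Seminorm_le_of_bound_of_support
  l2Seminorm_le_sqrt_card_mul_norm sum_opNorm_le_sqrt_card_mul_l2Seminorm l2Seminorm_apply)
open Summit.QuantumFields.YangMills.BalabanUVNodes.N12RightInverseLevelZeroLocality (mem_bondsOf_Bj_zero)
open B16Ineq17NearFlatWilsonLetters (fderiv_wilsonAction4_expChart_apply_eq_deriv)
open Summit.QuantumFields.YangMills.BalabanUVNodes.N12NearFlatFederbushFibreRecord (hcons_of_plaqsInside_maxDomT)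
open Summit.QuantumFields.YangMills.BalabanUVNodes.N12NearFlatFederbushFibreWindowKnit (runSite_runSite_blockSite_mem_tower)
open Summit.QuantumFields.YangMills.BalabanUVNodes.N12NearFlatFederbushVelocityWindow (exists_hmX_federbush_window_of_isMinimizer_family)
open Summit.QuantumFields.YangMills.BalabanUVNodes.N12DirectChartLetterCore (exists_twistSize_of_nearFlat_feeds abs_fderiv_wilsonAction4_expChart_apply_le_of_plaqSmall norm_le_sqrt_sum_sq)
open Summit.QuantumFields.YangMills.BalabanUVNodes.N12DirectChartLetterHSupportVacuity (hHsupp_levelZeroFree_of_rightInverse fderiv_fderiv_msChart_levelZeroFree_direct)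

open Summit.QuantumFields.YangMills.BalabanUVNodes.N12NearFlatFederbushVelocityWindow (hmX_federbush_window_of_delta2Component)
open Summit.QuantumFields.YangMills.BalabanUVNodes.N12NearFlatDelta2LetterComponent (exists_delta2_letter_component)
open Summit.QuantumFields.YangMills.BalabanUVNodes.N12DirectChartPackageRepaired (chartRows_direct_of_letters' exists_hWD_chartHalf_of_letters')

variable {F : T4Family}



/-- ★★★ **THE CHART HALF WITH ITS FOUR CONSTANTS QUANTIFIED PER HEIGHT, BEFORE THE INSTANCE** (lane finding LOCATED-FLOOR, 2026-08-28T22:10Z): `exists_hWD_chartHalf_of_letters'`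
VERBATIM except that `∃ C ρ K_τ ρ_τ` now stands BEFORE `ν`, `Z`, `Λ`, `T`, `lo`, `hi` (and their two geometry rows) — the constants depend on the height `(F, Kt, k)` ONLY, not on the run's
numerics `ν` (in particular not on the class threshold `ν.εreg`), not on the region `Z`, not on any guard or tolerance.  WHY: the direct road's endpoint builds its tolerance threshold
`δ₀` from these constants; with `∃` born after `ν` a consumer can never compare the class-threshold floor «`εreg`-tolerance ≤ δ ≤ δ₀» with `δ₀`, and the `∃ δ₀`-vs-floor frame is vacuous by
shape (`B15Prop1NumericsThresholds.exists_threshold_frame_of_pos_floor`).  With this edition the endpoint displays the constants as BINDERS `(C ρ K_τ ρ_τ : ι → ℝ)` with ONE chart-half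
letter (this ∀-body at `k i`), dischargeable by name BEFORE `ν` is fixed, and an EXPLICIT threshold.  Proof: §2's, with dag-n12-w4's `exists_delta2_letter_component k Q hQ0 hQs p₀ hp₀`
(the (δ₂)-component constants: height-only) and `exists_twistSize_of_nearFlat_feeds Kt k` obtained FIRST and `hmX_federbush_window_of_delta2Component` applied per instance.
[cite: Balaban1989LargeFieldII, p.357, (1.7) p.358, (1.12)–(1.13) p.359; Balaban1985Variational, (45) p.285, (81)–(83) p.290, (172) p.305; Balaban1988Convergent, (2.2) p.255, (2.10)–(2.13) pp.256–257] -/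
theorem exists_hWD_chartHalf_of_letters_uniform (Kt : ℕ) (h0 : 0 < (F.P Kt).d) {k : ℕ} (hk0 : 0 < k) (hk : k ≤ (F.P Kt).m + (F.P Kt).K) :
    ∃ C ρ Kτ ρτ : ℝ, 0 ≤ C ∧ 0 < ρ ∧ 0 ≤ Kτ ∧ 0 < ρτ ∧
      ∀ (ν : Node00.Stage7Numerics) (Z Λ : Set (Site (F.P Kt) 0)) (T : Finset (PBond (F.P Kt) k)) (lo hi : Fin (F.P Kt).d → ℤ),
      (∀ κ, ((((hi κ - lo κ + 1).toNat + 3 : ℕ) : ℤ)) ≤ (F.P Kt).sitesPerDir k) →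
      (∀ (ν' : Fin (F.P Kt).d), ∀ z ∈ box (fun κ => (hi κ - lo κ + 1).toNat + 3) (fun κ => lo κ - 2),
        (castSite z : Site (F.P Kt) k) ∈ pts k (maxDomT ν.M₁ Z k) ∧ (castSite z : Site (F.P Kt) k).shift ⟨0, h0⟩ ∈ pts k (maxDomT ν.M₁ Z k) ∧
          (castSite z : Site (F.P Kt) k).shift ν' ∈ pts k (maxDomT ν.M₁ Z k)) →
      ∀ (ext : GaugeField (F.P Kt) k SU2 → GaugeField (F.P Kt) k SU2) (Vk : GaugeField (F.P Kt) k SU2) ⦃R 𝓐₀ : ℝ⦄, 0 < R → 0 ≤ 𝓐₀ →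
      ∀ (U₀ : GaugeField (F.P Kt) 0 SU2) (Xf : GaugeSlice (pts k Λ) T E3 → PBond (F.P Kt) 0 → lieSU (Fin 2)),
      IsMinimizer (Node00.avOfRecord F 2 Kt) (Node00.regMSCoPOfRecord F 2 ν Kt k (maxDomT ν.M₁ Z)) (Bj ν.M₁ Z k)
        (avgFamily (Node00.avOfRecord F 2 Kt) (qsstarGIter0 k (ext Vk))) U₀ →
      SmallBelow (Node00.avOfRecord F 2 Kt) k U₀ →
      ∀ ⦃εP : ℝ⦄, 0 ≤ εP →
      (∀ p : Plaq (F.P Kt) 0, ((⟨p.src, p.μ⟩ : PBond (F.P Kt) 0) ∈ {b : PBond (F.P Kt) 0 | b.src ∈ maxDomT ν.M₁ Z 1} ∨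
          (⟨p.src.shift p.μ, p.ν⟩ : PBond (F.P Kt) 0) ∈ {b : PBond (F.P Kt) 0 | b.src ∈ maxDomT ν.M₁ Z 1} ∨
          (⟨p.src.shift p.ν, p.μ⟩ : PBond (F.P Kt) 0) ∈ {b : PBond (F.P Kt) 0 | b.src ∈ maxDomT ν.M₁ Z 1} ∨
          (⟨p.src, p.ν⟩ : PBond (F.P Kt) 0) ∈ {b : PBond (F.P Kt) 0 | b.src ∈ maxDomT ν.M₁ Z 1}) →
        ‖((GaugeField.plaqHol U₀ p : SU2) : Matrix (Fin 2) (Fin 2) ℂ) - 1‖ ≤ εP) →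
      ∀ (H : (Fin (constrCard (Bj ν.M₁ Z k) k) → lieSU (Fin 2)) → PBond (F.P Kt) 0 → lieSU (Fin 2)) ⦃B : ℝ⦄, 0 ≤ B →
      (∀ v, fderiv ℝ (msChart F 2 Kt k (Bj ν.M₁ Z k) (avgFamily (avOfRecord F 2 Kt) (qsstarGIter0 k (ext Vk))) U₀) 0 (H v) = v) →
      (∀ v, Real.sqrt (∑ b, ‖H v b‖ ^ 2) ≤ B * ‖v‖) →
      ∀ ⦃M₂ : ℝ⦄, 0 ≤ M₂ → (∀ w, ‖fderiv ℝ (fderiv ℝ (msChart F 2 Kt k (Bj ν.M₁ Z k) (avgFamily (avOfRecord F 2 Kt) (qsstarGIter0 k (ext Vk))) U₀)) 0 w w‖ ≤ M₂ * ‖w‖ ^ 2) →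
      Xf 0 = 0 → ContDiffAt ℝ 2 Xf 0 →
      (∀ᶠ Y in 𝓝 (0 : GaugeSlice (pts k Λ) T E3),
        IsMinimizer (Node00.avOfRecord F 2 Kt) (Node00.regMSCoPOfRecord F 2 ν Kt k (maxDomT ν.M₁ Z)) (Bj ν.M₁ Z k)
          (avgFamily (Node00.avOfRecord F 2 Kt) (qsstarGIter0 k (expMul su2Chart (ιA (pts k Λ) T Y) (ext Vk)))) (expChart U₀ (Xf Y))) →
      (∀ (X : GaugeSlice (pts k Λ) T E3) (b : PBond (F.P Kt) 0),
        ‖((fderiv ℝ Xf 0 X b : lieSU (Fin 2)) : Matrix (Fin 2) (Fin 2) ℂ)‖ ≤ 8 * 𝓐₀ / R * ‖X‖ ∧ ‖fderiv ℝ Xf 0 X b‖ ≤ 12 * 𝓐₀ / R * ‖X‖) →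
      (∀ (X : GaugeSlice (pts k Λ) T E3) (b : PBond (F.P Kt) 0), b.src ∉ maxDomT ν.M₁ Z 1 → fderiv ℝ Xf 0 X b = 0) →
      ∀ (W : Finset (Plaq (F.P Kt) 0)),
      (∀ q : Plaq (F.P Kt) 0, q.src ∈ ((box (fun κ => (F.P Kt).L ^ k * ((hi κ - lo κ + 1).toNat + 3 + 1) - 1) (fun κ => ((F.P Kt).L : ℤ) ^ k * (lo κ - 2))).image
          (fun z => (castSite z : Site (F.P Kt) 0))) → q ∈ W) →
      ∀ ⦃δW : ℝ⦄, 0 < δW → δW < ρ → δW < ρτ →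
      (∀ (ν' : Fin (F.P Kt).d), ∀ z ∈ box (fun κ => (hi κ - lo κ + 1).toNat + 3) (fun κ => lo κ - 2), ∀ b₀ : PBond (F.P Kt) 0,
        (b₀ ∈ feeds k (⟨(castSite z : Site (F.P Kt) k), ⟨0, h0⟩⟩ : PBond (F.P Kt) k) ∨ b₀ ∈ feeds k (⟨((castSite z : Site (F.P Kt) k)).shift ⟨0, h0⟩, ν'⟩ : PBond (F.P Kt) k)
        ∨ b₀ ∈ feeds k (⟨((castSite z : Site (F.P Kt) k)).shift ν', ⟨0, h0⟩⟩ : PBond (F.P Kt) k) ∨ b₀ ∈ feeds k (⟨(castSite z : Site (F.P Kt) k), ν'⟩ : PBond (F.P Kt) k)) →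
        ‖((U₀ b₀ : SU2) : Matrix (Fin 2) (Fin 2) ℂ) - 1‖ ≤ δW) →
      ∃ (Ψ₂ : (PBond (F.P Kt) 0 → lieSU (Fin 2)) →L[ℝ] (PBond (F.P Kt) 0 → lieSU (Fin 2)) →L[ℝ] (Fin (constrCard (Bj ν.M₁ Z k) k) → lieSU (Fin 2)))
        (lam : (Fin (constrCard (Bj ν.M₁ Z k) k) → lieSU (Fin 2)) →L[ℝ] ℝ)
        (p : Seminorm ℝ (PBond (F.P Kt) 0 → lieSU (Fin 2))),
        HasFDerivAt (fun Y => fderiv ℝ (msChart F 2 Kt k (Bj ν.M₁ Z k) (avgFamily (avOfRecord F 2 Kt) (qsstarGIter0 k (ext Vk))) U₀) Y) Ψ₂ 0 ∧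
        (∀ᶠ Y in 𝓝 (0 : PBond (F.P Kt) 0 → lieSU (Fin 2)), DifferentiableAt ℝ (msChart F 2 Kt k (Bj ν.M₁ Z k) (avgFamily (avOfRecord F 2 Kt) (qsstarGIter0 k (ext Vk))) U₀) Y) ∧
        fderiv ℝ (fun Y : PBond (F.P Kt) 0 → lieSU (Fin 2) => wilsonAction4 (expChart U₀ Y)) 0 = lam.comp (fderiv ℝ (msChart F 2 Kt k (Bj ν.M₁ Z k) (avgFamily (avOfRecord F 2 Kt) (qsstarGIter0 k (ext Vk))) U₀) 0) ∧
        (∀ Y : PBond (F.P Kt) 0 → lieSU (Fin 2), ∑ b, ‖(Y b : Matrix (Fin 2) (Fin 2) ℂ)‖ ^ 2 ≤ p Y ^ 2) ∧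
        ∀ X : GaugeSlice (pts k Λ) T E3,
          lam (Ψ₂ (fderiv ℝ Xf 0 X) (fderiv ℝ Xf 0 X))
              ≤ (2 * (((F.P Kt).d : ℝ) - 1) * εP * Real.sqrt (Fintype.card (PBond (F.P Kt) 0)) * B * M₂) * p (fderiv ℝ Xf 0 X) ^ 2 ∧
          p (fderiv ℝ Xf 0 X) ≤ (12 * 𝓐₀ / R * Real.sqrt (Nat.card {b : PBond (F.P Kt) 0 // b.src ∈ maxDomT ν.M₁ Z 1})) * ‖X‖ ∧
          (((F.P Kt).L : ℝ) ^ (F.P Kt).d) ^ k / ((((F.P Kt).L : ℝ)) ^ 2 * ((F.P Kt).L : ℝ) ^ 2) ^ k / 2 * (∑ z ∈ box (fun κ => (hi κ - lo κ + 1).toNat + 3) (fun κ => lo κ - 2), ∑ μ : Fin (F.P Kt).d, ∑ a : Fin 3, curl (fun b => ιA (pts k Λ) T X (⟨castSite b.1, b.2⟩ : PBond (F.P Kt) k) a) z ⟨0, h0⟩ μ ^ 2)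
              - (((F.P Kt).L : ℝ) ^ (F.P Kt).d) ^ k / ((((F.P Kt).L : ℝ)) ^ 2 * ((F.P Kt).L : ℝ) ^ 2) ^ k * (8 * (((F.P Kt).d : ℝ) + 1) * (2 * (Kτ + 1) * δW) + 8 * ((F.P Kt).d : ℝ) * (((box (fun κ => (hi κ - lo κ + 1).toNat + 3) (fun κ => lo κ - 2)).image (fun z => (castSite z : Site (F.P Kt) k))).card : ℝ) * (C * δW * (12 * 𝓐₀ / R * Real.sqrt (Nat.card {b : PBond (F.P Kt) 0 // b.src ∈ maxDomT ν.M₁ Z 1}))) ^ 2) * ‖X‖ ^ 2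
            ≤ ((Fintype.card (Fin 2) : ℝ)⁻¹ • ∑ p ∈ W, (innerSL ℝ (E := lieSU (Fin 2))).bilinearComp
              (ContinuousLinearMap.proj (R := ℝ) (φ := fun _ : PBond (F.P Kt) 0 => lieSU (Fin 2)) (⟨p.src, p.μ⟩ : PBond (F.P Kt) 0) + ContinuousLinearMap.proj (R := ℝ) (φ := fun _ : PBond (F.P Kt) 0 => lieSU (Fin 2)) (⟨p.src.shift p.μ, p.ν⟩ : PBond (F.P Kt) 0)
                - ContinuousLinearMap.proj (R := ℝ) (φ := fun _ : PBond (F.P Kt) 0 => lieSU (Fin 2)) (⟨p.src.shift p.ν, p.μ⟩ : PBond (F.P Kt) 0) - ContinuousLinearMap.proj (R := ℝ) (φ := fun _ : PBond (F.P Kt) 0 => lieSU (Fin 2)) (⟨p.src, p.ν⟩ : PBond (F.P Kt) 0) : (PBond (F.P Kt) 0 → lieSU (Fin 2)) →L[ℝ] lieSU (Fin 2))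
              (ContinuousLinearMap.proj (R := ℝ) (φ := fun _ : PBond (F.P Kt) 0 => lieSU (Fin 2)) (⟨p.src, p.μ⟩ : PBond (F.P Kt) 0) + ContinuousLinearMap.proj (R := ℝ) (φ := fun _ : PBond (F.P Kt) 0 => lieSU (Fin 2)) (⟨p.src.shift p.μ, p.ν⟩ : PBond (F.P Kt) 0)
                - ContinuousLinearMap.proj (R := ℝ) (φ := fun _ : PBond (F.P Kt) 0 => lieSU (Fin 2)) (⟨p.src.shift p.ν, p.μ⟩ : PBond (F.P Kt) 0) - ContinuousLinearMap.proj (R := ℝ) (φ := fun _ : PBond (F.P Kt) 0 => lieSU (Fin 2)) (⟨p.src, p.ν⟩ : PBond (F.P Kt) 0) : (PBond (F.P Kt) 0 → lieSU (Fin 2)) →L[ℝ] lieSU (Fin 2))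
              : (PBond (F.P Kt) 0 → lieSU (Fin 2)) →L[ℝ] (PBond (F.P Kt) 0 → lieSU (Fin 2)) →L[ℝ] ℝ) (fderiv ℝ Xf 0 X) (fderiv ℝ Xf 0 X) := by
  classical
  -- ### the `linAvg` iterate and the explicit junction seminorm (for the velocity-form clause's constants)
  let Q : (i : ℕ) → (PBond (F.P Kt) 0 → Matrix (Fin 2) (Fin 2) ℂ) → PBond (F.P Kt) i → Matrix (Fin 2) (Fin 2) ℂ := fun i =>
    Nat.rec (motive := fun i => (PBond (F.P Kt) 0 → Matrix (Fin 2) (Fin 2) ℂ) → PBond (F.P Kt) i → Matrix (Fin 2) (Fin 2) ℂ)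
      (fun Y => Y) (fun _ q Y c => linAvg (q Y) c) i
  have hQ0 : ∀ Y, Q 0 Y = Y := fun Y => rfl
  have hQs : ∀ (i : ℕ) (Y : PBond (F.P Kt) 0 → Matrix (Fin 2) (Fin 2) ℂ) (c : PBond (F.P Kt) (i + 1)), Q (i + 1) Y c = linAvg (Q i Y) c :=
    fun i Y c => rfl
  let p₀ : Seminorm ℝ (PBond (F.P Kt) 0 → lieSU (Fin 2)) :=
    (normSeminorm ℝ (PiLp 2 (fun _ : PBond (F.P Kt) 0 => lieSU (Fin 2)))).comp (WithLp.linearEquiv 2 ℝ (PBond (F.P Kt) 0 → lieSU (Fin 2))).symm.toLinearMap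
  have hp₀ : ∀ Y : PBond (F.P Kt) 0 → lieSU (Fin 2), ∑ b, ‖(Y b : Matrix (Fin 2) (Fin 2) ℂ)‖ ^ 2 ≤ p₀ Y ^ 2 := fun Y => sum_opNorm_sq_le_l2Seminorm_sq Y
  -- ### the per-height constants
  obtain ⟨C, ρ, hC, hρ, hδ2⟩ := exists_delta2_letter_component (F := F) (N := 2) (K := Kt) k Q hQ0 hQs p₀ hp₀
  obtain ⟨Kτ, ρτ, hKτ, hρτ, htw⟩ := exists_twistSize_of_nearFlat_feeds (F := F) (N := 2) Kt k
  refine ⟨C, ρ, Kτ, ρτ, hC, hρ, hKτ, hρτ, ?_⟩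
  intro ν Z Λ T lo hi hbox hΩw ext Vk R 𝓐₀ hR h𝓐₀ U₀ Xf hmin0 hsb εP hεP0 hP H B hB0 hHinv hHB M₂ hM₂0 hM₂ hX₀ hXc hmin hKb hsupp W hWin δW hδW0 hδWρ hδWτ hδW
  -- ### the chart rows (P1)
  obtain ⟨Ψ₂, lam, p, hΨ₂, hΨd, hlam, hp, -, hrows⟩ :=
    chartRows_direct_of_letters' ν Kt hk0 Z Λ T ext Vk hR h𝓐₀ U₀ Xf hmin0 hsb hεP0 hP H hB0 hHinv hHB hM₂0 hM₂ hKb hsupp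
  refine ⟨Ψ₂, lam, p, hΨ₂, hΨd, hlam, hp, fun X => ⟨(hrows X).1, (hrows X).2, ?_⟩⟩
  -- ### the velocity-form Federbush clause: region letters discharged by the block tower of the box (as p646479 §1)
  have hUfib : AgreeOn (Bj ν.M₁ Z k) (avgFamily (avOfRecord F 2 Kt) U₀) (avgFamily (avOfRecord F 2 Kt) (qsstarGIter0 k (ext Vk))) := hmin0.2.1
  let Sset : (i : ℕ) → Finset (Site (F.P Kt) i) := fun i =>
    (box (fun κ => (F.P Kt).L ^ (k - i) * (((hi κ - lo κ + 1).toNat + 3) + 1) - 1) (fun κ => ((F.P Kt).L : ℤ) ^ (k - i) * (lo κ - 2))).image (fun z => (castSite z : Site (F.P Kt) i))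
  have hSk : Sset k = (box (fun κ => (hi κ - lo κ + 1).toNat + 3) (fun κ => lo κ - 2)).image (fun z => (castSite z : Site (F.P Kt) k)) := by
    simp only [Sset, Nat.sub_self, pow_zero, one_mul, Nat.add_sub_cancel]
  have hwin : ∀ z ∈ box (fun κ => (hi κ - lo κ + 1).toNat + 3) (fun κ => lo κ - 2), (castSite z : Site (F.P Kt) k) ∈ Sset k := fun z hz => by
    rw [hSk]
    exact Finset.mem_image_of_mem _ hz
  have hS : ∀ (ν' : Fin (F.P Kt).d), (⟨0, h0⟩ : Fin (F.P Kt).d) ≠ ν' → ∀ i, i < k → ∀ y ∈ Sset (i + 1), ∀ (r : Fin (F.P Kt).d → Fin (F.P Kt).L) (s t : ℕ),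
      s < (F.P Kt).L → t < (F.P Kt).L → runSite (runSite (Site.blockSite y r) ⟨0, h0⟩ s) ν' t ∈ Sset i := by
    intro ν' hν i hi y hy r s t hs ht
    exact runSite_runSite_blockSite_mem_tower h0 (lt_of_lt_of_le hi hk) hν hi hy r hs ht
  have hΩk : ∀ (ν' : Fin (F.P Kt).d), ∀ s ∈ Sset k, s ∈ pts k (maxDomT ν.M₁ Z k) ∧ s.shift ⟨0, h0⟩ ∈ pts k (maxDomT ν.M₁ Z k) ∧ s.shift ν' ∈ pts k (maxDomT ν.M₁ Z k) := by
    intro ν' s hs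
    rw [hSk, Finset.mem_image] at hs
    obtain ⟨z, hz, rfl⟩ := hs
    exact hΩw ν' z hz
  have hW0 : ∀ q : Plaq (F.P Kt) 0, q.src ∈ Sset 0 → q ∈ W := fun q hq => hWin q (by simpa only [Sset, Nat.sub_zero] using hq)
  have hcons := hcons_of_plaqsInside_maxDomT h0 Z (Sset k) hΩk
  -- near-flatness on the feeds of the region's plaquette bonds, re-indexed through `S_k = castSite″ box`
  have hδW' : ∀ (ν' : Fin (F.P Kt).d), ∀ s ∈ Sset k, ∀ b₀ : PBond (F.P Kt) 0,
      (b₀ ∈ feeds k (⟨s, ⟨0, h0⟩⟩ : PBond (F.P Kt) k) ∨ b₀ ∈ feeds k (⟨(s).shift ⟨0, h0⟩, ν'⟩ : PBond (F.P Kt) k)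
        ∨ b₀ ∈ feeds k (⟨(s).shift ν', ⟨0, h0⟩⟩ : PBond (F.P Kt) k) ∨ b₀ ∈ feeds k (⟨s, ν'⟩ : PBond (F.P Kt) k)) →
      ‖((U₀ b₀ : SU 2) : Matrix (Fin 2) (Fin 2) ℂ) - 1‖ ≤ δW := by
    intro ν' s hs b₀ hb₀
    rw [hSk, Finset.mem_image] at hs
    obtain ⟨z, hz, rfl⟩ := hs
    exact hδW ν' z hz b₀ hb₀
  -- the twist size at the region's plaquette bonds from the tower near-flatness
  have htwb : ∀ (c : PBond (F.P Kt) k), c ∈ bondsOf (Bj ν.M₁ Z k k) →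
      (∀ b₀ ∈ feeds k c, ‖((U₀ b₀ : SU 2) : Matrix (Fin 2) (Fin 2) ℂ) - 1‖ ≤ δW) →
      ‖((avgFamily (avOfRecord F 2 Kt) (qsstarGIter0 k (ext Vk)) k c : SU 2) : Matrix (Fin 2) (Fin 2) ℂ) - 1‖ ≤ (2 * (Kτ + 1) * δW) / 2 := by
    intro c hc hloc
    have h := htw (Bj ν.M₁ Z k) (avgFamily (avOfRecord F 2 Kt) (qsstarGIter0 k (ext Vk))) U₀ hk hUfib c hc hδW0.le hδWτ hloc
    have h2 : Kτ * δW ≤ (2 * (Kτ + 1) * δW) / 2 := by nlinarith [hδW0.le]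
    exact h.trans h2
  have hW' : ∀ (ν' : Fin (F.P Kt).d), ∀ s ∈ Sset k,
      ‖((avgFamily (avOfRecord F 2 Kt) (qsstarGIter0 k (ext Vk)) k ⟨s, ⟨0, h0⟩⟩ : SU 2) : Matrix (Fin 2) (Fin 2) ℂ) - 1‖ ≤ (2 * (Kτ + 1) * δW) / 2 ∧
      ‖((avgFamily (avOfRecord F 2 Kt) (qsstarGIter0 k (ext Vk)) k ⟨s.shift ⟨0, h0⟩, ν'⟩ : SU 2) : Matrix (Fin 2) (Fin 2) ℂ) - 1‖ ≤ (2 * (Kτ + 1) * δW) / 2 ∧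
      ‖((avgFamily (avOfRecord F 2 Kt) (qsstarGIter0 k (ext Vk)) k ⟨s.shift ν', ⟨0, h0⟩⟩ : SU 2) : Matrix (Fin 2) (Fin 2) ℂ) - 1‖ ≤ (2 * (Kτ + 1) * δW) / 2 ∧
      ‖((avgFamily (avOfRecord F 2 Kt) (qsstarGIter0 k (ext Vk)) k ⟨s, ν'⟩ : SU 2) : Matrix (Fin 2) (Fin 2) ℂ) - 1‖ ≤ (2 * (Kτ + 1) * δW) / 2 := by
    intro ν' s hs
    obtain ⟨h1, h2, h3, h4⟩ := hcons ν' s hs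
    exact ⟨htwb _ h1 fun b₀ hb₀ => hδW' ν' s hs b₀ (Or.inl hb₀), htwb _ h2 fun b₀ hb₀ => hδW' ν' s hs b₀ (Or.inr (Or.inl hb₀)),
      htwb _ h3 fun b₀ hb₀ => hδW' ν' s hs b₀ (Or.inr (Or.inr (Or.inl hb₀))), htwb _ h4 fun b₀ hb₀ => hδW' ν' s hs b₀ (Or.inr (Or.inr (Or.inr hb₀)))⟩
  have hτ : 0 < (2 * (Kτ + 1) * δW) := by positivity
  have hΨ : DifferentiableAt ℝ (msChart F 2 Kt k (Bj ν.M₁ Z k) (avgFamily (avOfRecord F 2 Kt) (qsstarGIter0 k (ext Vk))) U₀) 0 := differentiableAt_msChart hUfib hsb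
  have hX1 : HasFDerivAt Xf (fderiv ℝ Xf 0) 0 := (hXc.differentiableAt two_ne_zero).hasFDerivAt
  have hη0 : (0 : ℝ) < 1 / 2 := by norm_num
  have hη1 : (1 : ℝ) / 2 < 1 := by norm_num
  -- (K) for the explicit seminorm `p₀`
  have hK0 : ∀ X' : GaugeSlice (pts k Λ) T E3, p₀ (fderiv ℝ Xf 0 X') ≤ (12 * 𝓐₀ / R * Real.sqrt (Nat.card {b : PBond (F.P Kt) 0 // b.src ∈ maxDomT ν.M₁ Z 1})) * ‖X'‖ := by
    intro X'
    have ha : 0 ≤ 12 * 𝓐₀ / R * ‖X'‖ := by positivity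
    have h := l2Seminorm_le_of_bound_of_support (N := 2) (maxDomT ν.M₁ Z 1) (fderiv ℝ Xf 0 X') ha (fun b => (hKb X' b).2) (fun b hb => hsupp X' b hb)
    calc p₀ (fderiv ℝ Xf 0 X') ≤ Real.sqrt (Nat.card {b : PBond (F.P Kt) 0 // b.src ∈ maxDomT ν.M₁ Z 1}) * (12 * 𝓐₀ / R * ‖X'‖) := h
      _ = (12 * 𝓐₀ / R * Real.sqrt (Nat.card {b : PBond (F.P Kt) 0 // b.src ∈ maxDomT ν.M₁ Z 1})) * ‖X'‖ := by ring
  -- the velocity-form clause at `η = 1∕2` (Pauli coordinates eliminated in term mode)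
  have key := exists_lieSU2Coord.elim fun φ hφ =>
    hmX_federbush_window_of_delta2Component h0 hk Q hQ0 hQs p₀ hδ2 Z X (fun κ => lo κ - 2) hbox Sset hwin hS hφ hΩk (regMSCoPOfRecord F 2 ν Kt k (maxDomT ν.M₁ Z)) (ext Vk) U₀ hX₀ hmin hX1 hΨ hτ hW' W hW0 hδW0.le hδWρ hδW' hη0 hη1
  -- arithmetic: `(C·δ_W·p₀(X_f′X))² ≤ (C·δ_W·Kc)²‖X‖²`, `|S_k|` of the statement = `(S_k).card`
  have hcard : ((Sset k).card : ℝ) = (((box (fun κ => (hi κ - lo κ + 1).toNat + 3) (fun κ => lo κ - 2)).image (fun z => (castSite z : Site (F.P Kt) k))).card : ℝ) := by rw [hSk]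
  have hpK : (C * δW * p₀ (fderiv ℝ Xf 0 X)) ^ 2 ≤ (C * δW * (12 * 𝓐₀ / R * Real.sqrt (Nat.card {b : PBond (F.P Kt) 0 // b.src ∈ maxDomT ν.M₁ Z 1}))) ^ 2 * ‖X‖ ^ 2 := by
    have h1 : 0 ≤ C * δW * p₀ (fderiv ℝ Xf 0 X) := by positivity
    have h2 : C * δW * p₀ (fderiv ℝ Xf 0 X) ≤ C * δW * ((12 * 𝓐₀ / R * Real.sqrt (Nat.card {b : PBond (F.P Kt) 0 // b.src ∈ maxDomT ν.M₁ Z 1})) * ‖X‖) := mul_le_mul_of_nonneg_left (hK0 X) (by positivity)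
    calc (C * δW * p₀ (fderiv ℝ Xf 0 X)) ^ 2 ≤ (C * δW * ((12 * 𝓐₀ / R * Real.sqrt (Nat.card {b : PBond (F.P Kt) 0 // b.src ∈ maxDomT ν.M₁ Z 1})) * ‖X‖)) ^ 2 := pow_le_pow_left₀ h1 h2 2
      _ = (C * δW * (12 * 𝓐₀ / R * Real.sqrt (Nat.card {b : PBond (F.P Kt) 0 // b.src ∈ maxDomT ν.M₁ Z 1}))) ^ 2 * ‖X‖ ^ 2 := by ring
  have hratio : 0 ≤ (((F.P Kt).L : ℝ) ^ (F.P Kt).d) ^ k / ((((F.P Kt).L : ℝ)) ^ 2 * ((F.P Kt).L : ℝ) ^ 2) ^ k := by positivity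
  have hinv : ((1 : ℝ) / 2)⁻¹ - 1 = 1 := by norm_num
  have hhalf : (1 : ℝ) - 1 / 2 = 1 / 2 := by norm_num
  rw [hinv, hhalf, one_mul, hcard] at key
  have h3 : (((F.P Kt).L : ℝ) ^ (F.P Kt).d) ^ k / ((((F.P Kt).L : ℝ)) ^ 2 * ((F.P Kt).L : ℝ) ^ 2) ^ k * (8 * ((F.P Kt).d : ℝ) * (((box (fun κ => (hi κ - lo κ + 1).toNat + 3) (fun κ => lo κ - 2)).image (fun z => (castSite z : Site (F.P Kt) k))).card : ℝ) * (C * δW * p₀ (fderiv ℝ Xf 0 X)) ^ 2)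
      ≤ (((F.P Kt).L : ℝ) ^ (F.P Kt).d) ^ k / ((((F.P Kt).L : ℝ)) ^ 2 * ((F.P Kt).L : ℝ) ^ 2) ^ k * (8 * ((F.P Kt).d : ℝ) * (((box (fun κ => (hi κ - lo κ + 1).toNat + 3) (fun κ => lo κ - 2)).image (fun z => (castSite z : Site (F.P Kt) k))).card : ℝ) * ((C * δW * (12 * 𝓐₀ / R * Real.sqrt (Nat.card {b : PBond (F.P Kt) 0 // b.src ∈ maxDomT ν.M₁ Z 1}))) ^ 2 * ‖X‖ ^ 2)) :=
    mul_le_mul_of_nonneg_left (mul_le_mul_of_nonneg_left hpK (by positivity)) hratio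
  refine le_trans ?_ key
  linarith [h3]


/-- ★★ **THE FAMILY FORM — the consumer's one-liner.**  For an instance family with heights `k i` (`0 < k i ≤ m + K`) there are constant FAMILIES `C ρ K_τ ρ_τ : ι → ℝ` (by `choose`,
one 4-tuple per height, depending on `(F, Kt, k i)` only) with the signs and, for every `i`, the ∀-body of `exists_hWD_chartHalf_of_letters_uniform` at height `k i` — LITERALLY the
displayed chart-half letter `hhalf i` of the explicit-threshold endpoint (P2c)′ `N12Prop1DirectOfChartHalfExplicit`, which this theorem therefore discharges BEFORE `ν` (the run's
numerics, in particular the class threshold `εreg`), the regions, the guards and the tolerances are fixed.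
[cite: Balaban1989LargeFieldII, p.357, (1.7) p.358, (1.12)–(1.13) p.359; Balaban1985Variational, (45) p.285, (81)–(83) p.290; Balaban1988Convergent, (2.2) p.255, (2.10)–(2.13) pp.256–257] -/
theorem exists_hWD_chartHalf_of_letters_uniform_family (Kt : ℕ) (h0 : 0 < (F.P Kt).d) {ι : Type*} (k : ι → ℕ) (hk0 : ∀ i, 0 < k i)
    (hk : ∀ i, k i ≤ (F.P Kt).m + (F.P Kt).K) :
    ∃ C ρ Kτ ρτ : ι → ℝ, (∀ i, 0 ≤ C i) ∧ (∀ i, 0 < ρ i) ∧ (∀ i, 0 ≤ Kτ i) ∧ (∀ i, 0 < ρτ i) ∧ ∀ i,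
        ∀ (ν : Node00.Stage7Numerics) (Z Λ : Set (Site (F.P Kt) 0)) (T : Finset (PBond (F.P Kt) (k i))) (lo hi : Fin (F.P Kt).d → ℤ),
        (∀ κ, ((((hi κ - lo κ + 1).toNat + 3 : ℕ) : ℤ)) ≤ (F.P Kt).sitesPerDir (k i)) →
        (∀ (ν' : Fin (F.P Kt).d), ∀ z ∈ box (fun κ => (hi κ - lo κ + 1).toNat + 3) (fun κ => lo κ - 2),
          (castSite z : Site (F.P Kt) (k i)) ∈ pts (k i) (maxDomT ν.M₁ Z (k i)) ∧ (castSite z : Site (F.P Kt) (k i)).shift ⟨0, h0⟩ ∈ pts (k i) (maxDomT ν.M₁ Z (k i)) ∧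
            (castSite z : Site (F.P Kt) (k i)).shift ν' ∈ pts (k i) (maxDomT ν.M₁ Z (k i))) →
        ∀ (ext : GaugeField (F.P Kt) (k i) SU2 → GaugeField (F.P Kt) (k i) SU2) (Vk : GaugeField (F.P Kt) (k i) SU2) ⦃R 𝓐₀ : ℝ⦄, 0 < R → 0 ≤ 𝓐₀ →
        ∀ (U₀ : GaugeField (F.P Kt) 0 SU2) (Xf : GaugeSlice (pts (k i) Λ) T E3 → PBond (F.P Kt) 0 → lieSU (Fin 2)),
        IsMinimizer (Node00.avOfRecord F 2 Kt) (Node00.regMSCoPOfRecord F 2 ν Kt (k i) (maxDomT ν.M₁ Z)) (Bj ν.M₁ Z (k i))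
          (avgFamily (Node00.avOfRecord F 2 Kt) (qsstarGIter0 (k i) (ext Vk))) U₀ →
        SmallBelow (Node00.avOfRecord F 2 Kt) (k i) U₀ →
        ∀ ⦃εP : ℝ⦄, 0 ≤ εP →
        (∀ p : Plaq (F.P Kt) 0, ((⟨p.src, p.μ⟩ : PBond (F.P Kt) 0) ∈ {b : PBond (F.P Kt) 0 | b.src ∈ maxDomT ν.M₁ Z 1} ∨
            (⟨p.src.shift p.μ, p.ν⟩ : PBond (F.P Kt) 0) ∈ {b : PBond (F.P Kt) 0 | b.src ∈ maxDomT ν.M₁ Z 1} ∨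
            (⟨p.src.shift p.ν, p.μ⟩ : PBond (F.P Kt) 0) ∈ {b : PBond (F.P Kt) 0 | b.src ∈ maxDomT ν.M₁ Z 1} ∨
            (⟨p.src, p.ν⟩ : PBond (F.P Kt) 0) ∈ {b : PBond (F.P Kt) 0 | b.src ∈ maxDomT ν.M₁ Z 1}) →
          ‖((GaugeField.plaqHol U₀ p : SU2) : Matrix (Fin 2) (Fin 2) ℂ) - 1‖ ≤ εP) →
        ∀ (H : (Fin (constrCard (Bj ν.M₁ Z (k i)) (k i)) → lieSU (Fin 2)) → PBond (F.P Kt) 0 → lieSU (Fin 2)) ⦃B : ℝ⦄, 0 ≤ B →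
        (∀ v, fderiv ℝ (msChart F 2 Kt (k i) (Bj ν.M₁ Z (k i)) (avgFamily (avOfRecord F 2 Kt) (qsstarGIter0 (k i) (ext Vk))) U₀) 0 (H v) = v) →
        (∀ v, Real.sqrt (∑ b, ‖H v b‖ ^ 2) ≤ B * ‖v‖) →
        ∀ ⦃M₂ : ℝ⦄, 0 ≤ M₂ → (∀ w, ‖fderiv ℝ (fderiv ℝ (msChart F 2 Kt (k i) (Bj ν.M₁ Z (k i)) (avgFamily (avOfRecord F 2 Kt) (qsstarGIter0 (k i) (ext Vk))) U₀)) 0 w w‖ ≤ M₂ * ‖w‖ ^ 2) →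
        Xf 0 = 0 → ContDiffAt ℝ 2 Xf 0 →
        (∀ᶠ Y in 𝓝 (0 : GaugeSlice (pts (k i) Λ) T E3),
          IsMinimizer (Node00.avOfRecord F 2 Kt) (Node00.regMSCoPOfRecord F 2 ν Kt (k i) (maxDomT ν.M₁ Z)) (Bj ν.M₁ Z (k i))
            (avgFamily (Node00.avOfRecord F 2 Kt) (qsstarGIter0 (k i) (expMul su2Chart (ιA (pts (k i) Λ) T Y) (ext Vk)))) (expChart U₀ (Xf Y))) →
        (∀ (X : GaugeSlice (pts (k i) Λ) T E3) (b : PBond (F.P Kt) 0),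
          ‖((fderiv ℝ Xf 0 X b : lieSU (Fin 2)) : Matrix (Fin 2) (Fin 2) ℂ)‖ ≤ 8 * 𝓐₀ / R * ‖X‖ ∧ ‖fderiv ℝ Xf 0 X b‖ ≤ 12 * 𝓐₀ / R * ‖X‖) →
        (∀ (X : GaugeSlice (pts (k i) Λ) T E3) (b : PBond (F.P Kt) 0), b.src ∉ maxDomT ν.M₁ Z 1 → fderiv ℝ Xf 0 X b = 0) →
        ∀ (W : Finset (Plaq (F.P Kt) 0)),
        (∀ q : Plaq (F.P Kt) 0, q.src ∈ ((box (fun κ => (F.P Kt).L ^ (k i) * ((hi κ - lo κ + 1).toNat + 3 + 1) - 1) (fun κ => ((F.P Kt).L : ℤ) ^ (k i) * (lo κ - 2))).image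
            (fun z => (castSite z : Site (F.P Kt) 0))) → q ∈ W) →
        ∀ ⦃δW : ℝ⦄, 0 < δW → δW < (ρ i) → δW < (ρτ i) →
        (∀ (ν' : Fin (F.P Kt).d), ∀ z ∈ box (fun κ => (hi κ - lo κ + 1).toNat + 3) (fun κ => lo κ - 2), ∀ b₀ : PBond (F.P Kt) 0,
          (b₀ ∈ feeds (k i) (⟨(castSite z : Site (F.P Kt) (k i)), ⟨0, h0⟩⟩ : PBond (F.P Kt) (k i)) ∨ b₀ ∈ feeds (k i) (⟨((castSite z : Site (F.P Kt) (k i))).shift ⟨0, h0⟩, ν'⟩ : PBond (F.P Kt) (k i))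
          ∨ b₀ ∈ feeds (k i) (⟨((castSite z : Site (F.P Kt) (k i))).shift ν', ⟨0, h0⟩⟩ : PBond (F.P Kt) (k i)) ∨ b₀ ∈ feeds (k i) (⟨(castSite z : Site (F.P Kt) (k i)), ν'⟩ : PBond (F.P Kt) (k i))) →
          ‖((U₀ b₀ : SU2) : Matrix (Fin 2) (Fin 2) ℂ) - 1‖ ≤ δW) →
        ∃ (Ψ₂ : (PBond (F.P Kt) 0 → lieSU (Fin 2)) →L[ℝ] (PBond (F.P Kt) 0 → lieSU (Fin 2)) →L[ℝ] (Fin (constrCard (Bj ν.M₁ Z (k i)) (k i)) → lieSU (Fin 2)))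
          (lam : (Fin (constrCard (Bj ν.M₁ Z (k i)) (k i)) → lieSU (Fin 2)) →L[ℝ] ℝ)
          (p : Seminorm ℝ (PBond (F.P Kt) 0 → lieSU (Fin 2))),
          HasFDerivAt (fun Y => fderiv ℝ (msChart F 2 Kt (k i) (Bj ν.M₁ Z (k i)) (avgFamily (avOfRecord F 2 Kt) (qsstarGIter0 (k i) (ext Vk))) U₀) Y) Ψ₂ 0 ∧
          (∀ᶠ Y in 𝓝 (0 : PBond (F.P Kt) 0 → lieSU (Fin 2)), DifferentiableAt ℝ (msChart F 2 Kt (k i) (Bj ν.M₁ Z (k i)) (avgFamily (avOfRecord F 2 Kt) (qsstarGIter0 (k i) (ext Vk))) U₀) Y) ∧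
          fderiv ℝ (fun Y : PBond (F.P Kt) 0 → lieSU (Fin 2) => wilsonAction4 (expChart U₀ Y)) 0 = lam.comp (fderiv ℝ (msChart F 2 Kt (k i) (Bj ν.M₁ Z (k i)) (avgFamily (avOfRecord F 2 Kt) (qsstarGIter0 (k i) (ext Vk))) U₀) 0) ∧
          (∀ Y : PBond (F.P Kt) 0 → lieSU (Fin 2), ∑ b, ‖(Y b : Matrix (Fin 2) (Fin 2) ℂ)‖ ^ 2 ≤ p Y ^ 2) ∧
          ∀ X : GaugeSlice (pts (k i) Λ) T E3,
            lam (Ψ₂ (fderiv ℝ Xf 0 X) (fderiv ℝ Xf 0 X))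
                ≤ (2 * (((F.P Kt).d : ℝ) - 1) * εP * Real.sqrt (Fintype.card (PBond (F.P Kt) 0)) * B * M₂) * p (fderiv ℝ Xf 0 X) ^ 2 ∧
            p (fderiv ℝ Xf 0 X) ≤ (12 * 𝓐₀ / R * Real.sqrt (Nat.card {b : PBond (F.P Kt) 0 // b.src ∈ maxDomT ν.M₁ Z 1})) * ‖X‖ ∧
            (((F.P Kt).L : ℝ) ^ (F.P Kt).d) ^ (k i) / ((((F.P Kt).L : ℝ)) ^ 2 * ((F.P Kt).L : ℝ) ^ 2) ^ (k i) / 2 * (∑ z ∈ box (fun κ => (hi κ - lo κ + 1).toNat + 3) (fun κ => lo κ - 2), ∑ μ : Fin (F.P Kt).d, ∑ a : Fin 3, curl (fun b => ιA (pts (k i) Λ) T X (⟨castSite b.1, b.2⟩ : PBond (F.P Kt) (k i)) a) z ⟨0, h0⟩ μ ^ 2)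
                - (((F.P Kt).L : ℝ) ^ (F.P Kt).d) ^ (k i) / ((((F.P Kt).L : ℝ)) ^ 2 * ((F.P Kt).L : ℝ) ^ 2) ^ (k i) * (8 * (((F.P Kt).d : ℝ) + 1) * (2 * ((Kτ i) + 1) * δW) + 8 * ((F.P Kt).d : ℝ) * (((box (fun κ => (hi κ - lo κ + 1).toNat + 3) (fun κ => lo κ - 2)).image (fun z => (castSite z : Site (F.P Kt) (k i)))).card : ℝ) * ((C i) * δW * (12 * 𝓐₀ / R * Real.sqrt (Nat.card {b : PBond (F.P Kt) 0 // b.src ∈ maxDomT ν.M₁ Z 1}))) ^ 2) * ‖X‖ ^ 2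
              ≤ ((Fintype.card (Fin 2) : ℝ)⁻¹ • ∑ p ∈ W, (innerSL ℝ (E := lieSU (Fin 2))).bilinearComp
                (ContinuousLinearMap.proj (R := ℝ) (φ := fun _ : PBond (F.P Kt) 0 => lieSU (Fin 2)) (⟨p.src, p.μ⟩ : PBond (F.P Kt) 0) + ContinuousLinearMap.proj (R := ℝ) (φ := fun _ : PBond (F.P Kt) 0 => lieSU (Fin 2)) (⟨p.src.shift p.μ, p.ν⟩ : PBond (F.P Kt) 0)
                  - ContinuousLinearMap.proj (R := ℝ) (φ := fun _ : PBond (F.P Kt) 0 => lieSU (Fin 2)) (⟨p.src.shift p.ν, p.μ⟩ : PBond (F.P Kt) 0) - ContinuousLinearMap.proj (R := ℝ) (φ := fun _ : PBond (F.P Kt) 0 => lieSU (Fin 2)) (⟨p.src, p.ν⟩ : PBond (F.P Kt) 0) : (PBond (F.P Kt) 0 → lieSU (Fin 2)) →L[ℝ] lieSU (Fin 2))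
                (ContinuousLinearMap.proj (R := ℝ) (φ := fun _ : PBond (F.P Kt) 0 => lieSU (Fin 2)) (⟨p.src, p.μ⟩ : PBond (F.P Kt) 0) + ContinuousLinearMap.proj (R := ℝ) (φ := fun _ : PBond (F.P Kt) 0 => lieSU (Fin 2)) (⟨p.src.shift p.μ, p.ν⟩ : PBond (F.P Kt) 0)
                  - ContinuousLinearMap.proj (R := ℝ) (φ := fun _ : PBond (F.P Kt) 0 => lieSU (Fin 2)) (⟨p.src.shift p.ν, p.μ⟩ : PBond (F.P Kt) 0) - ContinuousLinearMap.proj (R := ℝ) (φ := fun _ : PBond (F.P Kt) 0 => lieSU (Fin 2)) (⟨p.src, p.ν⟩ : PBond (F.P Kt) 0) : (PBond (F.P Kt) 0 → lieSU (Fin 2)) →L[ℝ] lieSU (Fin 2))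
                : (PBond (F.P Kt) 0 → lieSU (Fin 2)) →L[ℝ] (PBond (F.P Kt) 0 → lieSU (Fin 2)) →L[ℝ] ℝ) (fderiv ℝ Xf 0 X) (fderiv ℝ Xf 0 X) := by
  choose C ρ Kτ ρτ hC hρ hKτ hρτ hh using fun i => exists_hWD_chartHalf_of_letters_uniform (F := F) Kt h0 (hk0 i) (hk i)
  exact ⟨C, ρ, Kτ, ρτ, hC, hρ, hKτ, hρτ, hh⟩

end Summit.QuantumFields.YangMills.BalabanUVNodes.N12DirectChartPackageUniform

end
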